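import Summits.KontsevichZagierPeriods.KontsevichZagierPeriods.Theses.SymplecticScissors
import Literature.NumberTheory.Transcendental.KZLogCalculusProofs
import Literature.NumberTheory.Transcendental.SemialgebraicGrounding
import Literature.NumberTheory.Transcendental.SemialgebraicVolume
import Literature.ModelTheory.ExponentialFields.SemialgebraicInterior

/-!
# `PlanarSAZylev` (crux `stmt-KontsevichZagierPeriods-9848`, route `SymplecticScissors`), line
# `reservoir-peeling`: small planar models for the negative-side analysis of its stubs (drefute seat)

Pure geometry, no route statement involved: the open unit square `sq = (0,1)²` and its rational
translate `sq2 = sq + (2,0)` (rational translations are `ℚ`-semialgebraic maps: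
`isSemialgebraicMapOn_translate`), the base interval `I01 ⊆ ℝ¹` and the bands `band a b` over it in
the `Fin.init`/`Fin.last` coordinates used by the skeleton's grounding stubs, the big square
`bigSq = (0,2)²`, the coordinate swap `swapCLM` (det `-1`), the open quadrant `quad` (a `ℚ`-semialgebraic coordinatewise down-set of INFINITE
area), and two NON-semialgebraic sets `irrSq = sq ∖ ratLines`, `irrBig = bigSq ∖ ratLines` (the
rational abscissae removed: positive area, EMPTY interior, so every `ℚ`-semialgebraic subset is null —
`volume_eq_zero_of_isSemialgebraic_subset_diff_ratLines`, via `KZ.volume_eq_zero_of_interior_eq_empty`).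
Consumed by `ReservoirPeelingStubMutations.lean`.
-/

set_option linter.dupNamespace false

noncomputable section

namespace Summit.KontsevichZagierPeriods.KontsevichZagierPeriods.Theorems.PlanarSAZylev.Negative

open Set MeasureTheory Function Filter Topology MvPolynomial
open scoped ENNReal
open Literature.NumberTheory.Transcendental Literature.ModelTheory.ExponentialFields

/-! ### Coordinate half-spaces, the unit square, rational translations -/

/-- `{x | a < xᵢ}` is `ℚ`-semialgebraic. -/
theorem isSemialgebraic_coord_gt {n : ℕ} (i : Fin n) (a : ℚ) :
    IsSemialgebraic ℚ {x : Fin n → ℝ | (a : ℝ) < x i} := by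
  convert isSemialgebraic_setOf_eval_pos (R := ℝ) (X i - C a : MvPolynomial (Fin n) ℚ) using 1
  ext x
  simp [sub_pos]

/-- `{x | xᵢ < b}` is `ℚ`-semialgebraic. -/
theorem isSemialgebraic_coord_lt {n : ℕ} (i : Fin n) (b : ℚ) :
    IsSemialgebraic ℚ {x : Fin n → ℝ | x i < (b : ℝ)} := by
  convert isSemialgebraic_setOf_eval_pos (R := ℝ) (C b - X i : MvPolynomial (Fin n) ℚ) using 1
  ext x
  simp [sub_pos]

/-- The open unit square `(0,1)²`. -/
def sq : Set (Fin 2 → ℝ) := Set.pi univ fun _ => Ioo 0 1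

/-- Membership in the unit square, coordinatewise. -/
theorem mem_sq {x : Fin 2 → ℝ} : x ∈ sq ↔ ∀ i, 0 < x i ∧ x i < 1 := by
  simp [sq, Set.mem_pi]

/-- The unit square is `ℚ`-semialgebraic. -/
theorem isSemialgebraic_sq : IsSemialgebraic ℚ sq := by
  have h : sq = ({x | ((0 : ℚ) : ℝ) < x 0} ∩ {x | x 0 < ((1 : ℚ) : ℝ)}) ∩
      ({x | ((0 : ℚ) : ℝ) < x 1} ∩ {x | x 1 < ((1 : ℚ) : ℝ)}) := by
    ext x
    simp [sq, Set.mem_pi, Fin.forall_fin_two]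
  rw [h]
  exact ((isSemialgebraic_coord_gt 0 0).inter (isSemialgebraic_coord_lt 0 1)).inter
    ((isSemialgebraic_coord_gt 1 0).inter (isSemialgebraic_coord_lt 1 1))

/-- The unit square has area `1`. -/
theorem volume_sq : volume sq = 1 := by
  have := Real.volume_pi_Ioo (a := fun _ : Fin 2 => (0 : ℝ)) (b := fun _ => 1)
  simpa [sq] using this

/-- The unit square is open. -/
theorem isOpen_sq : IsOpen sq := isOpen_set_pi finite_univ fun _ _ => isOpen_Ioo

/-- The unit square is bounded. -/
theorem isBounded_sq : Bornology.IsBounded sq := Bornology.IsBounded.pi fun _ => Metric.isBounded_Ioo 0 1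

/-- The Jacobian determinant of the identity of the plane is `1`. -/
theorem det_id_two : (ContinuousLinearMap.id ℝ (Fin 2 → ℝ)).det = 1 := by
  simp [ContinuousLinearMap.det]

/-- The real translation vector of a rational vector. -/
def tv (v : Fin 2 → ℚ) : Fin 2 → ℝ := fun i => (v i : ℝ)

/-- `tv` is compatible with negation. -/
theorem tv_neg (v : Fin 2 → ℚ) : tv (-v) = -tv v := by
  funext i; simp [tv]

/-- A rational translate of a `ℚ`-semialgebraic planar set is `ℚ`-semialgebraic. -/
theorem isSemialgebraic_translate (v : Fin 2 → ℚ) {σ : Set (Fin 2 → ℝ)} (hσ : IsSemialgebraic ℚ σ) :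
    IsSemialgebraic ℚ ((fun x => x + tv v) '' σ) := by
  have h := hσ.preimage_aeval (fun j : Fin 2 => (X j - C (v j) : MvPolynomial (Fin 2) ℚ))
  convert h using 1
  ext y
  simp only [mem_image, mem_preimage, map_sub, aeval_X, aeval_C, eq_ratCast]
  constructor
  · rintro ⟨x, hx, rfl⟩
    convert hx using 1
    funext j
    simp [tv]
  · intro hy
    refine ⟨fun j => y j - (v j : ℝ), hy, ?_⟩
    funext j
    simp [tv]

/-- Translation by a rational vector is a `ℚ`-semialgebraic map. -/
theorem isSemialgebraicMapOn_translate (v : Fin 2 → ℚ) {σ : Set (Fin 2 → ℝ)} (hσ : IsSemialgebraic ℚ σ) :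
    IsSemialgebraicMapOn ℚ σ (fun x => x + tv v) := by
  unfold IsSemialgebraicMapOn
  rw [setOf_exists_eq_append]
  have hA : IsSemialgebraic ℚ {z : Fin (2 + 2) → ℝ | (fun i => z (Fin.castAdd 2 i)) ∈ σ} := by
    simpa [Set.preimage, Function.comp_def] using hσ.preimage_comp (Fin.castAdd 2)
  have hB : IsSemialgebraic ℚ {z : Fin (2 + 2) → ℝ |
      (fun j => z (Fin.natAdd 2 j)) = (fun i => z (Fin.castAdd 2 i)) + tv v} := by
    have h0 := isSemialgebraic_setOf_eval_eq_zero (R := ℝ)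
      (X (Fin.natAdd 2 0) - X (Fin.castAdd 2 0) - C (v 0) : MvPolynomial (Fin (2 + 2)) ℚ)
    have h1 := isSemialgebraic_setOf_eval_eq_zero (R := ℝ)
      (X (Fin.natAdd 2 1) - X (Fin.castAdd 2 1) - C (v 1) : MvPolynomial (Fin (2 + 2)) ℚ)
    convert h0.inter h1 using 1
    ext z
    simp only [mem_setOf_eq, mem_inter_iff, map_sub, aeval_X, aeval_C, eq_ratCast, funext_iff,
      Fin.forall_fin_two, Pi.add_apply, tv]
    constructor
    · rintro ⟨e0, e1⟩
      exact ⟨by rw [e0]; ring, by rw [e1]; ring⟩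
    · rintro ⟨e0, e1⟩
      exact ⟨by linarith, by linarith⟩
  rw [Set.setOf_and]
  exact hA.inter hB

/-- Translates have the same area. -/
theorem volume_translate (v : Fin 2 → ℚ) (σ : Set (Fin 2 → ℝ)) :
    volume ((fun x => x + tv v) '' σ) = volume σ := by
  rw [image_add_right, measure_preimage_add_right]

/-- The translate `(2,3) × (0,1)` of the unit square by `(2, 0)`. -/
def sq2 : Set (Fin 2 → ℝ) := (fun x => x + tv ![2, 0]) '' sq

/-- `sq2` has area `1`. -/
theorem volume_sq2 : volume sq2 = 1 := by rw [sq2, volume_translate, volume_sq]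

/-- `sq2` is measurable (open). -/
theorem measurableSet_sq2 : MeasurableSet sq2 :=
  ((isOpenMap_add_right (tv ![2, 0])) sq isOpen_sq).measurableSet

/-- Points of `sq2` have abscissa `> 2`. -/
theorem two_lt_of_mem_sq2 {y : Fin 2 → ℝ} (hy : y ∈ sq2) : (2 : ℝ) < y 0 := by
  obtain ⟨x, hx, rfl⟩ := hy
  have := (mem_sq.mp hx 0).1
  simp [tv]
  linarith

/-- The unit square and its translate are disjoint. -/
theorem disjoint_sq_sq2 : Disjoint sq sq2 := by
  rw [disjoint_left]
  intro y hy hy2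
  have h1 := (mem_sq.mp hy 0).2
  have h2 := two_lt_of_mem_sq2 hy2
  linarith

/-- Together they have area `2`. -/
theorem volume_sq_union_sq2 : volume (sq ∪ sq2) = 2 := by
  rw [measure_union disjoint_sq_sq2 measurableSet_sq2, volume_sq, volume_sq2]
  norm_num

/-- The coordinate swap of the plane as a continuous linear map (matrix `!![0, 1; 1, 0]`). -/
def swapCLM : (Fin 2 → ℝ) →L[ℝ] (Fin 2 → ℝ) :=
  LinearMap.toContinuousLinearMap (Matrix.toLin' !![(0 : ℝ), 1; 1, 0])

/-- The swap exchanges the two coordinates. -/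
theorem swapCLM_apply (x : Fin 2 → ℝ) : swapCLM x = ![x 1, x 0] := by
  ext i
  fin_cases i <;> simp [swapCLM, Matrix.toLin'_apply, Matrix.mulVec, dotProduct, Fin.sum_univ_two]

/-- The swap has determinant `-1`. -/
theorem det_swapCLM : swapCLM.det = -1 := by
  rw [ContinuousLinearMap.det, swapCLM, LinearMap.coe_toContinuousLinearMap, LinearMap.det_toLin']
  simp [Matrix.det_fin_two]

/-- The swap is injective. -/
theorem swapCLM_injective : Function.Injective swapCLM := by
  intro x y h
  rw [swapCLM_apply, swapCLM_apply] at h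
  ext i
  fin_cases i
  · simpa using congrFun h 1
  · simpa using congrFun h 0

/-! ### Bands over the base interval, the big square, the quadrant -/

/-- The open unit interval of the base line `ℝ¹`. -/
def I01 : Set (Fin 1 → ℝ) := {x | 0 < x 0 ∧ x 0 < 1}

/-- `I01` is `ℚ`-semialgebraic. -/
theorem isSemialgebraic_I01 : IsSemialgebraic ℚ I01 := by
  have := (isSemialgebraic_coord_gt (n := 1) 0 0).inter (isSemialgebraic_coord_lt (n := 1) 0 1)
  convert this using 1
  ext x; simp [I01]

/-- `I01` is open. -/
theorem isOpen_I01 : IsOpen I01 :=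
  (isOpen_lt continuous_const (continuous_apply 0)).inter (isOpen_lt (continuous_apply 0) continuous_const)

/-- Rational constants are `ℚ`-semialgebraic functions (on a `ℚ`-semialgebraic base). -/
theorem isSemialgebraicFunOn_ratConst {s : Set (Fin 1 → ℝ)} (hs : IsSemialgebraic ℚ s) (q : ℚ) :
    IsSemialgebraicFunOn ℚ s (fun _ => (q : ℝ)) := by
  have := isSemialgebraicFunOn_aeval hs (MvPolynomial.C q : MvPolynomial (Fin 1) ℚ)
  convert this using 2 with x
  simp

/-- The open band over `I01` between the heights `a` and `b`, written in the stubs'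
`Fin.init`/`Fin.last` coordinates. -/
def band (a b : ℝ) : Set (Fin 2 → ℝ) := {z | Fin.init z ∈ I01 ∧ a < z (Fin.last 1) ∧ z (Fin.last 1) < b}

/-- A band is a coordinate box. -/
theorem band_eq_pi (a b : ℝ) :
    band a b = Set.pi univ fun i => Ioo ((![0, a] : Fin 2 → ℝ) i) ((![1, b] : Fin 2 → ℝ) i) := by
  ext z
  simp [band, I01, Fin.init, Set.mem_pi, Fin.forall_fin_two]

/-- The area of a band is its height (for `a ≤ b`; `0` otherwise). -/
theorem volume_band (a b : ℝ) : volume (band a b) = ENNReal.ofReal (b - a) := by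
  rw [band_eq_pi, Real.volume_pi_Ioo]
  simp [Fin.prod_univ_two]

/-- The big open square `(0,2)²`. -/
def bigSq : Set (Fin 2 → ℝ) := Set.pi univ fun _ => Ioo 0 2

/-- `bigSq` is `ℚ`-semialgebraic. -/
theorem isSemialgebraic_bigSq : IsSemialgebraic ℚ bigSq := by
  have h : bigSq = ({x | ((0 : ℚ) : ℝ) < x 0} ∩ {x | x 0 < ((2 : ℚ) : ℝ)}) ∩
      ({x | ((0 : ℚ) : ℝ) < x 1} ∩ {x | x 1 < ((2 : ℚ) : ℝ)}) := by
    ext x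
    simp [bigSq, Set.mem_pi, Fin.forall_fin_two]
  rw [h]
  exact ((isSemialgebraic_coord_gt 0 0).inter (isSemialgebraic_coord_lt 0 2)).inter
    ((isSemialgebraic_coord_gt 1 0).inter (isSemialgebraic_coord_lt 1 2))

/-- `bigSq` has area `4`. -/
theorem volume_bigSq : volume bigSq = 4 := by
  have := Real.volume_pi_Ioo (a := fun _ : Fin 2 => (0 : ℝ)) (b := fun _ => 2)
  simp only [sub_zero, Finset.prod_const, Finset.card_univ, Fintype.card_fin] at this
  rw [bigSq, this, ENNReal.ofReal_ofNat]
  norm_num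

/-- `bigSq` is bounded. -/
theorem isBounded_bigSq : Bornology.IsBounded bigSq := Bornology.IsBounded.pi fun _ => Metric.isBounded_Ioo 0 2

/-- The open positive quadrant: a `ℚ`-semialgebraic coordinatewise down-set of INFINITE area. -/
def quad : Set (Fin 2 → ℝ) := {x | ∀ i, 0 < x i}

/-- `quad` is `ℚ`-semialgebraic. -/
theorem isSemialgebraic_quad : IsSemialgebraic ℚ quad := by
  have := (isSemialgebraic_coord_gt (n := 2) 0 0).inter (isSemialgebraic_coord_gt (n := 2) 1 0)
  convert this using 1
  ext x; simp [quad, Fin.forall_fin_two]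

/-- `quad` has infinite area. -/
theorem volume_quad : volume quad = ⊤ := by
  have h : quad = Set.pi univ fun _ : Fin 2 => Ioi (0 : ℝ) := by ext x; simp [quad, Set.mem_pi]
  rw [h, volume_pi_pi]
  simp

/-! ### Non-semialgebraic models: squares with the rational abscissae removed -/

/-- The points of the plane with RATIONAL abscissa: a countable union of null vertical lines. -/
def ratLines : Set (Fin 2 → ℝ) := {p | p 0 ∈ range ((↑) : ℚ → ℝ)}

/-- `ratLines` is null. -/
theorem volume_ratLines : volume ratLines = 0 := by
  have h : ratLines = ⋃ q : ℚ, {p : Fin 2 → ℝ | p 0 = (q : ℝ)} := by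
    ext p; simp [ratLines, eq_comm]
  rw [h, measure_iUnion_null_iff]
  intro q
  have := Measure.pi_hyperplane (fun _ : Fin 2 => (volume : Measure ℝ)) 0 (q : ℝ)
  rwa [← volume_pi] at this

/-- Every non-empty open planar set meets `ratLines` (rationals are dense): an open set avoiding it is
empty. -/
theorem eq_empty_of_isOpen_of_forall_not_mem_ratLines {U : Set (Fin 2 → ℝ)} (hUo : IsOpen U)
    (hU : ∀ p ∈ U, p ∉ ratLines) : U = ∅ := by
  rcases eq_empty_or_nonempty U with h | ⟨x, hx⟩
  · exact h
  exfalso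
  have hc : Continuous fun t : ℝ => Function.update x 0 t := continuous_const.update 0 continuous_id
  have hV : IsOpen ((fun t : ℝ => Function.update x 0 t) ⁻¹' U) := hUo.preimage hc
  have hxV : x 0 ∈ (fun t : ℝ => Function.update x 0 t) ⁻¹' U := by simpa using hx
  obtain ⟨ε, hε, hball⟩ := Metric.isOpen_iff.1 hV (x 0) hxV
  obtain ⟨q, hq1, hq2⟩ := exists_rat_btwn (show x 0 < x 0 + ε by linarith)
  have hqball : (q : ℝ) ∈ Metric.ball (x 0) ε := by
    rw [Metric.mem_ball, Real.dist_eq, abs_lt]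
    constructor <;> linarith
  exact hU _ (hball hqball) ⟨q, by simp⟩

/-- An open subset of `S ∖ ratLines` is empty. -/
theorem eq_empty_of_isOpen_subset_diff_ratLines {U S : Set (Fin 2 → ℝ)} (hUo : IsOpen U)
    (hU : U ⊆ S \ ratLines) : U = ∅ :=
  eq_empty_of_isOpen_of_forall_not_mem_ratLines hUo fun _ hp => (hU hp).2

/-- A `ℚ`-semialgebraic subset of `S ∖ ratLines` is NULL: it has empty interior, and semialgebraic sets
with empty interior are null (`KZ.volume_eq_zero_of_interior_eq_empty`). -/
theorem volume_eq_zero_of_isSemialgebraic_subset_diff_ratLines {W S : Set (Fin 2 → ℝ)}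
    (hW : IsSemialgebraic ℚ W) (hWS : W ⊆ S \ ratLines) : volume W = 0 :=
  KZ.volume_eq_zero_of_interior_eq_empty hW
    (eq_empty_of_isOpen_subset_diff_ratLines isOpen_interior (interior_subset.trans hWS))

/-- The unit square with the rational abscissae removed: bounded, area `1`, empty interior. -/
def irrSq : Set (Fin 2 → ℝ) := sq \ ratLines

/-- `irrSq` has area `1`. -/
theorem volume_irrSq : volume irrSq = 1 := by rw [irrSq, measure_sdiff_null volume_ratLines, volume_sq]

/-- `irrSq` is bounded. -/
theorem isBounded_irrSq : Bornology.IsBounded irrSq := isBounded_sq.subset sdiff_subset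

/-- The big square with the rational abscissae removed: bounded, area `4`, empty interior. -/
def irrBig : Set (Fin 2 → ℝ) := bigSq \ ratLines

/-- `irrBig` has area `4`. -/
theorem volume_irrBig : volume irrBig = 4 := by rw [irrBig, measure_sdiff_null volume_ratLines, volume_bigSq]

/-- `irrBig` is bounded. -/
theorem isBounded_irrBig : Bornology.IsBounded irrBig := isBounded_bigSq.subset sdiff_subset

end Summit.KontsevichZagierPeriods.KontsevichZagierPeriods.Theorems.PlanarSAZylev.Negative


/-!
# `PlanarSAZylev` (crux `stmt-KontsevichZagierPeriods-9848`), line `reservoir-peeling` (skeleton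
# `0de51f8a563b`): the moves of the pinned relation that no stub provides (support, drefute seat)

The lead's skeleton pins ONE relation `E` on planar sets by the hypothesis
`hE : ∀ A B, E A B ↔ ∃ U Φ, U ⊆ A ∧ IsSemialgebraic ℚ U ∧ IsOpen U ∧ volume (A \ U) = 0 ∧
  IsSemialgebraicMapOn ℚ U Φ ∧ ContDiffOn ℝ 1 Φ U ∧ InjOn Φ U ∧ (∀ p ∈ U, |(fderiv ℝ Φ p).det| = 1) ∧
  Φ '' U ⊆ B ∧ volume (B \ Φ '' U) = 0`
and states its stubs in the form `∀ E, hE → …`. Everything below is proved for an ARBITRARY `E`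
satisfying `hE` (section variable), so it can be used verbatim inside the skeleton; none of it is one
of the eight stubs, all of it is consumed by the stub `stub_assembly` (the measured refinement monoid):

* `volume_eq_of_rel` — **`E` preserves area** (outer-measure squeeze on both sides and Mathlib's
  Jacobian formula on the open set `U`; this is also the second conjunct of `stub_teCalc`);
* `rel_refl`, `rel_translate`, `rel_translate_symm`, `rel_swap`, `rel_perm_swap` — identity, rational
  translations and the coordinate swap are moves; `rel_restrict` — a `ℚ`-semialgebraic co-null `A' ⊆ A`
  is related to `A` both ways (the `restriction` premise of `stub_groundLast`); `rel_of_null` — null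
  sets are related (null regions `≡ ∅`); `volume_eq_zero_of_rel_diff_ratLines` — a source with empty
  interior is null;
* `exists_downset_rel` — **two groundings**: from transitivity and the conclusion of `stub_groundLast`,
  every finite-area `ℚ`-semialgebraic `S` is related to a `ℚ`-semialgebraic coordinatewise DOWN-SET of
  the open positive quadrant with the same area (`groundLast (groundAt 0 S)`), i.e. exactly the input
  of `stub_downset` — `groundLast` alone grounds only the last coordinate.

Nothing here asserts a route statement.
-/

set_option linter.dupNamespace false

noncomputable section

namespace Summit.KontsevichZagierPeriods.KontsevichZagierPeriods.Theorems.PlanarSAZylev.Negative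

open Set MeasureTheory Function Filter Topology MvPolynomial
open scoped ENNReal
open Literature.NumberTheory.Transcendental Literature.ModelTheory.ExponentialFields

/-- Outer-measure squeeze: a subset with null complement has the same (outer) Lebesgue measure; no
measurability is needed. -/
theorem volume_eq_of_subset_of_diff_null {A U : Set (Fin 2 → ℝ)} (hUA : U ⊆ A)
    (h : volume (A \ U) = 0) : volume A = volume U := by
  refine le_antisymm ?_ (measure_mono hUA)
  calc volume A ≤ volume (A \ U ∪ U) := measure_mono (subset_sdiff_union A U)
    _ ≤ volume (A \ U) + volume U := measure_union_le _ _
    _ = volume U := by rw [h, zero_add]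

section Pinned

variable {E : Set (Fin 2 → ℝ) → Set (Fin 2 → ℝ) → Prop}
  (hE : ∀ A B : Set (Fin 2 → ℝ), E A B ↔ ∃ (U : Set (Fin 2 → ℝ)) (Φ : (Fin 2 → ℝ) → (Fin 2 → ℝ)),
    U ⊆ A ∧ IsSemialgebraic ℚ U ∧ IsOpen U ∧ volume (A \ U) = 0 ∧ IsSemialgebraicMapOn ℚ U Φ ∧
    ContDiffOn ℝ 1 Φ U ∧ InjOn Φ U ∧ (∀ p ∈ U, |(fderiv ℝ Φ p).det| = 1) ∧ Φ '' U ⊆ B ∧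
    volume (B \ Φ '' U) = 0)
include hE

/-! ### The pinned relation preserves area; identity and translations are moves -/

/-- **The pinned relation preserves area** (second conjunct of `stub_teCalc`): `vol A = vol U` and
`vol B = vol (Φ '' U)` by the squeeze (no measurability of `A`, `B` needed), and
`vol (Φ '' U) = ∫_U |det DΦ| = vol U` by `MeasureTheory.lintegral_abs_det_fderiv_eq_addHaar_image`. -/
theorem volume_eq_of_rel {A B : Set (Fin 2 → ℝ)} (h : E A B) : volume A = volume B := by
  obtain ⟨U, Φ, hUA, -, hUo, hAU, -, hΦc, hinj, hdet, hΦB, hBΦ⟩ := (hE A B).1 h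
  have hA : volume A = volume U := volume_eq_of_subset_of_diff_null hUA hAU
  have hB : volume B = volume (Φ '' U) := volume_eq_of_subset_of_diff_null hΦB hBΦ
  have hderiv : ∀ x ∈ U, HasFDerivWithinAt Φ (fderiv ℝ Φ x) U x := fun x hx =>
    (((hΦc.differentiableOn one_ne_zero) x hx).differentiableAt (hUo.mem_nhds hx)).hasFDerivAt.hasFDerivWithinAt
  have hJ := lintegral_abs_det_fderiv_eq_addHaar_image volume hUo.measurableSet hderiv hinj
  have hone : EqOn (fun x => ENNReal.ofReal |(fderiv ℝ Φ x).det|) (fun _ => 1) U := fun x hx => by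
    simp only [hdet x hx, ENNReal.ofReal_one]
  rw [setLIntegral_congr_fun hUo.measurableSet hone, setLIntegral_one] at hJ
  rw [hA, hB, hJ]

/-- Reflexivity on OPEN `ℚ`-semialgebraic sets (`Φ = id`). -/
theorem rel_refl {σ : Set (Fin 2 → ℝ)} (hσ : IsSemialgebraic ℚ σ) (hσo : IsOpen σ) : E σ σ :=
  (hE σ σ).2 ⟨σ, id, subset_rfl, hσ, hσo, by simp, isSemialgebraicMapOn_id hσ, contDiffOn_id, injOn_id _,
    fun p _ => by simp [det_id_two], by simp, by simp⟩

/-- Rational translations are moves on open `ℚ`-semialgebraic sets (forward direction). -/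
theorem rel_translate (v : Fin 2 → ℚ) {σ : Set (Fin 2 → ℝ)} (hσ : IsSemialgebraic ℚ σ) (hσo : IsOpen σ) :
    E σ ((fun x => x + tv v) '' σ) := by
  refine (hE _ _).2 ⟨σ, fun x => x + tv v, subset_rfl, hσ, hσo, by simp, isSemialgebraicMapOn_translate v hσ,
    contDiffOn_id.add contDiffOn_const, fun x _ y _ h => add_right_cancel h, fun p _ => ?_, subset_rfl, by simp⟩
  have : fderiv ℝ (fun x : Fin 2 → ℝ => x + tv v) p = ContinuousLinearMap.id ℝ _ := by
    rw [fderiv_add_const, fderiv_fun_id]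
  rw [this, det_id_two, abs_one]

/-- Rational translations are moves (backward direction: from the translate onto the set). -/
theorem rel_translate_symm (v : Fin 2 → ℚ) {σ : Set (Fin 2 → ℝ)} (hσ : IsSemialgebraic ℚ σ) (hσo : IsOpen σ) :
    E ((fun x => x + tv v) '' σ) σ := by
  have hσ' : IsSemialgebraic ℚ ((fun x => x + tv v) '' σ) := isSemialgebraic_translate v hσ
  have hσo' : IsOpen ((fun x => x + tv v) '' σ) := (isOpenMap_add_right (tv v)) σ hσo
  have himg : (fun x => x + tv (-v)) '' ((fun x => x + tv v) '' σ) = σ := by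
    rw [image_image, tv_neg]
    simp
  have := rel_translate hE (-v) hσ' hσo'
  rwa [himg] at this

/-- A move FROM a set avoiding the rational abscissae forces it to be null (its open part is empty). -/
theorem volume_eq_zero_of_rel_diff_ratLines {S B : Set (Fin 2 → ℝ)} (h : E (S \ ratLines) B) :
    volume (S \ ratLines) = 0 := by
  obtain ⟨U, Φ, hUA, -, hUo, hAU, -⟩ := (hE _ _).1 h
  have hU : U = ∅ := eq_empty_of_isOpen_subset_diff_ratLines hUo hUA
  subst hU
  simpa using hAU

/-- **Restriction** (the premise of `stub_groundLast` that is nobody's stub): a `ℚ`-semialgebraic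
co-null subset `A' ⊆ A` of an ARBITRARY set `A` is related to it both ways, by `Φ = id` on
`interior A'` (the frontier of a planar semialgebraic set is null). -/
theorem rel_restrict {A A' : Set (Fin 2 → ℝ)} (hA'A : A' ⊆ A) (hA' : IsSemialgebraic ℚ A')
    (hnull : volume (A \ A') = 0) : E A A' ∧ E A' A := by
  have hint : IsSemialgebraic ℚ (interior A') := isSemialgebraic_interior hA'
  have hfr : volume (A' \ interior A') = 0 :=
    measure_mono_null (fun x (hx : x ∈ A' \ interior A') => (⟨subset_closure hx.1, hx.2⟩ : x ∈ frontier A'))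
      (volume_frontier_eq_zero_of_isSemialgebraic hA')
  have hAU : volume (A \ interior A') = 0 := by
    refine measure_mono_null (fun x hx => ?_) (measure_union_null hnull hfr)
    by_cases h : x ∈ A'
    · exact Or.inr ⟨h, hx.2⟩
    · exact Or.inl ⟨hx.1, h⟩
  have hmap : IsSemialgebraicMapOn ℚ (interior A') id := isSemialgebraicMapOn_id hint
  refine ⟨(hE _ _).2 ⟨interior A', id, interior_subset.trans hA'A, hint, isOpen_interior, hAU, hmap,
      contDiffOn_id, injOn_id _, fun p _ => by simp [det_id_two], by simpa using interior_subset,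
      by simpa using hfr⟩,
    (hE _ _).2 ⟨interior A', id, interior_subset, hint, isOpen_interior, hfr, hmap, contDiffOn_id,
      injOn_id _, fun p _ => by simp [det_id_two], by simpa using interior_subset.trans hA'A,
      by simpa using hAU⟩⟩

/-- **Null sets are related to null sets** (`U = ∅`); in particular null regions are `~ ∅`. -/
theorem rel_of_null {A B : Set (Fin 2 → ℝ)} (hA : volume A = 0) (hB : volume B = 0) : E A B :=
  (hE _ _).2 ⟨∅, id, empty_subset _, isSemialgebraic_empty, isOpen_empty, by simpa using hA,
    isSemialgebraicMapOn_id isSemialgebraic_empty, contDiffOn_id, injOn_id _, fun _ h => h.elim,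
    by simp, by simpa using hB⟩

/-- **The coordinate swap is a move** on every open `ℚ`-semialgebraic set (`|det| = |-1| = 1`); the
assembly needs it to ground the FIRST coordinate before `stub_downset` (two groundings). -/
theorem rel_swap {σ : Set (Fin 2 → ℝ)} (hσ : IsSemialgebraic ℚ σ) (hσo : IsOpen σ) : E σ (swapCLM '' σ) := by
  have hmap : IsSemialgebraicMapOn ℚ σ swapCLM := by
    have := isSemialgebraicMapOn_aeval hσ
      (fun j : Fin 2 => (X (Equiv.swap (0 : Fin 2) 1 j) : MvPolynomial (Fin 2) ℚ))
    convert this using 2 with x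
    rw [swapCLM_apply]
    ext j
    fin_cases j <;> simp [Equiv.swap_apply_left, Equiv.swap_apply_right]
  refine (hE _ _).2 ⟨σ, swapCLM, subset_rfl, hσ, hσo, by simp, hmap, swapCLM.contDiff.contDiffOn,
    swapCLM_injective.injOn, fun p _ => ?_, subset_rfl, by simp⟩
  rw [swapCLM.fderiv, det_swapCLM]
  norm_num

/-- **The coordinate swap is a move on EVERY `ℚ`-semialgebraic set** (open part `interior σ`, image the
pulled-back set `Grounding.perm (swap 0 1) σ` up to the null image of the frontier). -/
theorem rel_perm_swap {S : Set (Fin 2 → ℝ)} (hS : IsSemialgebraic ℚ S) :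
    E S (Grounding.perm (Equiv.swap 0 (Fin.last 1)) S) := by
  have hswap : ∀ x : Fin 2 → ℝ, swapCLM x = x ∘ (Equiv.swap 0 (Fin.last 1)) := fun x => by
    rw [swapCLM_apply]; ext i; fin_cases i <;> rfl
  have hinv : ∀ x : Fin 2 → ℝ, swapCLM (swapCLM x) = x := fun x => by
    rw [swapCLM_apply, swapCLM_apply]; ext i; fin_cases i <;> rfl
  have hint : IsSemialgebraic ℚ (interior S) := isSemialgebraic_interior hS
  have hfr : volume (S \ interior S) = 0 :=
    measure_mono_null (fun x (hx : x ∈ S \ interior S) => (⟨subset_closure hx.1, hx.2⟩ : x ∈ frontier S))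
      (volume_frontier_eq_zero_of_isSemialgebraic hS)
  have hmap : IsSemialgebraicMapOn ℚ (interior S) swapCLM := by
    have := isSemialgebraicMapOn_aeval hint
      (fun j : Fin 2 => (X (Equiv.swap (0 : Fin 2) 1 j) : MvPolynomial (Fin 2) ℚ))
    convert this using 2 with x
    rw [swapCLM_apply]
    ext j
    fin_cases j <;> simp [Equiv.swap_apply_left, Equiv.swap_apply_right]
  have himg : swapCLM '' interior S ⊆ Grounding.perm (Equiv.swap 0 (Fin.last 1)) S := by
    rintro _ ⟨x, hx, rfl⟩
    show swapCLM x ∘ (Equiv.swap 0 (Fin.last 1)) ∈ S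
    rw [← hswap, hinv]
    exact interior_subset hx
  have hdiff : Grounding.perm (Equiv.swap 0 (Fin.last 1)) S \ swapCLM '' interior S ⊆
      Grounding.perm (Equiv.swap 0 (Fin.last 1)) (S \ interior S) := by
    rintro y ⟨hy, hy'⟩
    refine ⟨hy, fun h => hy' ⟨y ∘ (Equiv.swap 0 (Fin.last 1)), h, ?_⟩⟩
    rw [← hswap, hinv]
  have hnull : volume (Grounding.perm (Equiv.swap 0 (Fin.last 1)) S \ swapCLM '' interior S) = 0 := by
    refine measure_mono_null hdiff ?_
    rw [Grounding.volume_perm _ ((IsSemialgebraic.measurableSet_holds hS).diff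
      (IsSemialgebraic.measurableSet_holds hint))]
    exact hfr
  refine (hE _ _).2 ⟨interior S, swapCLM, interior_subset, hint, isOpen_interior, hfr, hmap,
    swapCLM.contDiff.contDiffOn, swapCLM_injective.injOn, fun p _ => ?_, himg, hnull⟩
  rw [swapCLM.fderiv, det_swapCLM]
  norm_num

/-- **Two groundings give a bounded-model candidate** (the normal form `stub_assembly` needs before
`stub_downset`): from transitivity and the grounding fact (`stub_groundLast`'s conclusion), every
finite-area `ℚ`-semialgebraic `S` is related to a `ℚ`-semialgebraic coordinatewise DOWN-SET `D` of the
open positive quadrant with the same area — `D := groundLast (groundAt 0 S)`. -/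
theorem exists_downset_rel (htrans : ∀ A B C : Set (Fin 2 → ℝ), E A B → E B C → E A C)
    (hground : ∀ S : Set (Fin 2 → ℝ), IsSemialgebraic ℚ S → volume S ≠ ⊤ → E S (Grounding.groundLast S))
    {S : Set (Fin 2 → ℝ)} (hS : IsSemialgebraic ℚ S) (hfin : volume S ≠ ⊤) :
    ∃ D : Set (Fin 2 → ℝ), IsSemialgebraic ℚ D ∧ volume D = volume S ∧ (∀ x ∈ D, ∀ i, 0 < x i) ∧
      (∀ x ∈ D, ∀ y : Fin 2 → ℝ, (∀ i, 0 < y i ∧ y i ≤ x i) → y ∈ D) ∧ E S D := by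
  have hmS := IsSemialgebraic.measurableSet_holds hS
  have hpS : IsSemialgebraic ℚ (Grounding.perm (Equiv.swap 0 (Fin.last 1)) S) :=
    Grounding.isSemialgebraic_perm _ hS
  have hvolpS : volume (Grounding.perm (Equiv.swap 0 (Fin.last 1)) S) ≠ ⊤ := by
    rwa [Grounding.volume_perm _ hmS]
  have h1 := rel_perm_swap hE hS
  have h2 := hground _ hpS hvolpS
  have hg : IsSemialgebraic ℚ (Grounding.groundLast (Grounding.perm (Equiv.swap 0 (Fin.last 1)) S)) :=
    Grounding.isSemialgebraic_groundLast hpS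
  have h3 := rel_perm_swap hE hg
  have hS₁ : E S (Grounding.groundAt 0 S) := htrans _ _ _ (htrans _ _ _ h1 h2) h3
  have hS₁sa : IsSemialgebraic ℚ (Grounding.groundAt 0 S) := Grounding.isSemialgebraic_groundAt 0 hS
  have hvolS₁ : volume (Grounding.groundAt 0 S) = volume S := Grounding.volume_groundAt 0 hS
  have h4 : E (Grounding.groundAt 0 S) (Grounding.groundLast (Grounding.groundAt 0 S)) :=
    hground _ hS₁sa (by rw [hvolS₁]; exact hfin)
  have hDsa : IsSemialgebraic ℚ (Grounding.groundLast (Grounding.groundAt 0 S)) :=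
    Grounding.isSemialgebraic_groundLast hS₁sa
  refine ⟨_, hDsa, ?_, ?_, ?_, htrans _ _ _ hS₁ h4⟩
  · rw [Grounding.volume_groundLast (IsSemialgebraic.measurableSet_holds hS₁sa)
      (IsSemialgebraic.measurableSet_holds hDsa), hvolS₁]
  · intro x hx i
    fin_cases i
    · exact Grounding.pos_of_mem_groundLast (j := 0) (by decide)
        (fun y hy => Grounding.pos_of_mem_groundAt_self 0 hy) hx
    · exact Grounding.pos_last_of_mem_groundLast hx
  · intro x hx y hy
    have step1 : Function.update x 0 (y 0) ∈ Grounding.groundLast (Grounding.groundAt 0 S) :=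
      Grounding.update_mem_groundLast (j := 0) (by decide)
        (fun z hz u hu0 hu => Grounding.update_mem_groundAt_self 0 hz hu0 hu) hx (hy 0).1 (hy 0).2
    have step2 := Grounding.update_last_mem_groundLast step1 (hy 1).1
      (show y 1 ≤ Function.update x 0 (y 0) (Fin.last 1) from by
        rw [Function.update_of_ne (by decide)]; exact (hy 1).2)
    have hl : (Fin.last 1 : Fin 2) = 1 := rfl
    have : Function.update (Function.update x 0 (y 0)) (Fin.last 1) (y 1) = y := by
      rw [hl]
      ext i
      fin_cases i <;> simp
    rwa [this] at step2

end Pinned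

end Summit.KontsevichZagierPeriods.KontsevichZagierPeriods.Theorems.PlanarSAZylev.Negative


/-!
# `PlanarSAZylev` (crux `stmt-KontsevichZagierPeriods-9848`), line `reservoir-peeling` (skeleton
# `0de51f8a563b`): eleven stub hypotheses are load-bearing (negative-side support, drefute seat)

For an ARBITRARY relation `E` satisfying the skeleton's pinning hypothesis `hE` (section variable, see
`ReservoirPeelingRelMoves.lean`), drop ONE hypothesis of a stub and a small `ℚ`-semialgebraic model
breaks it — so any proof of the stub must use that hypothesis:
`teGlue_false_without_nullOverlap`, `teGlue_false_without_disjointTargets` (`stub_teGlue`),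
`groundCell_false_without_order`, `groundCell_false_without_lt` (`stub_groundCell`),
`downset_false_without_finiteVolume` (`stub_downset`), `mosaic_false_without_lt`,
`mosaic_false_without_semialgB`, `mosaic_false_without_semialgA` (`stub_mosaic`),
`teCalc_refine_false_without_semialgA`, `teCalc_refine_false_without_semialgB` (`stub_teCalc`,
refinement conjunct), `groundLast_false_without_semialg` (`stub_groundLast`).

The un-mutated stubs are NOT refuted (they are true on paper; drefute note
`Cruxes/PlanarSAZylev/DrefuteReservoirPeeling.md`). Not load-bearing for TRUTH (no kill exists, variants
still true): boundedness in `stub_mosaic`, `volume S ≠ ⊤` in `stub_groundLast`, positivity / down-set in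
`stub_downset`, `ContinuousOn` / `IsOpen C` in `stub_groundCell`. Nothing here asserts a route statement.
-/

set_option linter.dupNamespace false

noncomputable section

namespace Summit.KontsevichZagierPeriods.KontsevichZagierPeriods.Theorems.PlanarSAZylev.Negative

open Set MeasureTheory Function Filter Topology MvPolynomial
open scoped ENNReal
open Literature.NumberTheory.Transcendental Literature.ModelTheory.ExponentialFields

section Pinned

variable {E : Set (Fin 2 → ℝ) → Set (Fin 2 → ℝ) → Prop}
  (hE : ∀ A B : Set (Fin 2 → ℝ), E A B ↔ ∃ (U : Set (Fin 2 → ℝ)) (Φ : (Fin 2 → ℝ) → (Fin 2 → ℝ)),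
    U ⊆ A ∧ IsSemialgebraic ℚ U ∧ IsOpen U ∧ volume (A \ U) = 0 ∧ IsSemialgebraicMapOn ℚ U Φ ∧
    ContDiffOn ℝ 1 Φ U ∧ InjOn Φ U ∧ (∀ p ∈ U, |(fderiv ℝ Φ p).det| = 1) ∧ Φ '' U ⊆ B ∧
    volume (B \ Φ '' U) = 0)
include hE

/-! ### `stub_teGlue`: both hypotheses are load-bearing -/

/-- Dropping the null-overlap hypothesis `volume (A₁ ∩ A₂) = 0` on the SOURCES is fatal:
`A₁ = A₂ = (0,1)²`, `B₁ = (0,1)²`, `B₂ = (0,1)² + (2,0)` (areas `1 ↦ 2`). -/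
theorem teGlue_false_without_nullOverlap :
    ¬ ∀ A₁ A₂ B₁ B₂ : Set (Fin 2 → ℝ), Disjoint B₁ B₂ → E A₁ B₁ → E A₂ B₂ → E (A₁ ∪ A₂) (B₁ ∪ B₂) := by
  intro h
  have h1 : E sq sq := rel_refl hE isSemialgebraic_sq isOpen_sq
  have h2 : E sq sq2 := rel_translate hE ![2, 0] isSemialgebraic_sq isOpen_sq
  have := volume_eq_of_rel hE (h sq sq sq sq2 disjoint_sq_sq2 h1 h2)
  rw [union_self, volume_sq, volume_sq_union_sq2] at this
  norm_num at this

/-- Dropping `Disjoint B₁ B₂` on the TARGETS is fatal (injectivity is pointwise; areas `2 ↦ 1`):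
`A₁ = (0,1)²`, `A₂ = (0,1)² + (2,0)`, `B₁ = B₂ = (0,1)²`. -/
theorem teGlue_false_without_disjointTargets :
    ¬ ∀ A₁ A₂ B₁ B₂ : Set (Fin 2 → ℝ), volume (A₁ ∩ A₂) = 0 → E A₁ B₁ → E A₂ B₂ → E (A₁ ∪ A₂) (B₁ ∪ B₂) := by
  intro h
  have h1 : E sq sq := rel_refl hE isSemialgebraic_sq isOpen_sq
  have h2 : E sq2 sq := rel_translate_symm hE ![2, 0] isSemialgebraic_sq isOpen_sq
  have h0 : volume (sq ∩ sq2) = 0 := by rw [disjoint_sq_sq2.inter_eq, measure_empty]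
  have := volume_eq_of_rel hE (h sq sq2 sq sq h0 h1 h2)
  rw [union_self, volume_sq, volume_sq_union_sq2] at this
  norm_num at this

/-! ### `stub_groundCell`: the order hypothesis and `f i < g i` are load-bearing -/

/-- Dropping the ORDER hypothesis `g i ≤ f i'` (`i < i'`): two copies of the unit band would have to fill
`(0,1) × (0,2)` (areas `1 ↦ 2`). -/
theorem groundCell_false_without_order :
    ¬ ∀ (k : ℕ) (C : Set (Fin 1 → ℝ)) (f g : Fin k → (Fin 1 → ℝ) → ℝ), IsOpen C → IsSemialgebraic ℚ C →
      (∀ i, IsSemialgebraicFunOn ℚ C (f i)) → (∀ i, IsSemialgebraicFunOn ℚ C (g i)) →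
      (∀ i, ContinuousOn (f i) C) → (∀ i, ContinuousOn (g i) C) → (∀ i, ∀ x ∈ C, f i x < g i x) →
      E (⋃ i, {z : Fin 2 → ℝ | Fin.init z ∈ C ∧ f i (Fin.init z) < z (Fin.last 1) ∧ z (Fin.last 1) < g i (Fin.init z)})
        {z : Fin 2 → ℝ | Fin.init z ∈ C ∧ 0 < z (Fin.last 1) ∧ z (Fin.last 1) < ∑ i, (g i (Fin.init z) - f i (Fin.init z))} := by
  intro h
  have h0 := h 2 I01 (fun _ _ => ((0 : ℚ) : ℝ)) (fun _ _ => ((1 : ℚ) : ℝ)) isOpen_I01 isSemialgebraic_I01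
    (fun _ => isSemialgebraicFunOn_ratConst isSemialgebraic_I01 0) (fun _ => isSemialgebraicFunOn_ratConst isSemialgebraic_I01 1)
    (fun _ => continuousOn_const) (fun _ => continuousOn_const) (fun _ _ _ => by norm_num)
  have hPE : E (band 0 1) (band 0 2) := by
    convert h0 using 2
    · ext z; simp [band]
    · ext z; simp [band]
  have hv := volume_eq_of_rel hE hPE
  rw [volume_band, volume_band] at hv
  norm_num at hv

/-- Dropping `f i < g i`: with the (ordered) data `f = (0, 3)`, `g = (1, 2)` the second band is empty and the
target height is `(1 − 0) + (2 − 3) = 0`, so the unit band would be related to `∅`. -/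
theorem groundCell_false_without_lt :
    ¬ ∀ (k : ℕ) (C : Set (Fin 1 → ℝ)) (f g : Fin k → (Fin 1 → ℝ) → ℝ), IsOpen C → IsSemialgebraic ℚ C →
      (∀ i, IsSemialgebraicFunOn ℚ C (f i)) → (∀ i, IsSemialgebraicFunOn ℚ C (g i)) →
      (∀ i, ContinuousOn (f i) C) → (∀ i, ContinuousOn (g i) C) →
      (∀ i i', i < i' → ∀ x ∈ C, g i x ≤ f i' x) →
      E (⋃ i, {z : Fin 2 → ℝ | Fin.init z ∈ C ∧ f i (Fin.init z) < z (Fin.last 1) ∧ z (Fin.last 1) < g i (Fin.init z)})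
        {z : Fin 2 → ℝ | Fin.init z ∈ C ∧ 0 < z (Fin.last 1) ∧ z (Fin.last 1) < ∑ i, (g i (Fin.init z) - f i (Fin.init z))} := by
  intro h
  have h0 := h 2 I01 (fun i _ => ((![0, 3] : Fin 2 → ℚ) i : ℝ)) (fun i _ => ((![1, 2] : Fin 2 → ℚ) i : ℝ))
    isOpen_I01 isSemialgebraic_I01
    (fun i => isSemialgebraicFunOn_ratConst isSemialgebraic_I01 _) (fun i => isSemialgebraicFunOn_ratConst isSemialgebraic_I01 _)
    (fun _ => continuousOn_const) (fun _ => continuousOn_const)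
    (fun i i' hii' x _ => by
      fin_cases i <;> fin_cases i' <;> simp at hii' ⊢)
  have hPE : E (band 0 1) ∅ := by
    convert h0 using 2
    · ext z
      simp only [band, mem_setOf_eq, mem_iUnion, Fin.exists_fin_two]
      simp
      intro _ h3 h2
      linarith
    · ext z
      simp [Fin.sum_univ_two]
      intro _ h1
      linarith
  have hv := volume_eq_of_rel hE hPE
  rw [volume_band, measure_empty] at hv
  norm_num at hv

/-! ### `stub_downset`: finiteness of the area is load-bearing -/

/-- Dropping `volume D ≠ ⊤`: the open quadrant is a `ℚ`-semialgebraic down-set of the positive orthant of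
infinite area, the relation preserves area and bounded sets have finite area. -/
theorem downset_false_without_finiteVolume :
    ¬ ∀ D : Set (Fin 2 → ℝ), IsSemialgebraic ℚ D → (∀ x ∈ D, ∀ i, 0 < x i) →
      (∀ x ∈ D, ∀ y : Fin 2 → ℝ, (∀ i, 0 < y i ∧ y i ≤ x i) → y ∈ D) →
      ∃ B : Set (Fin 2 → ℝ), IsSemialgebraic ℚ B ∧ Bornology.IsBounded B ∧ E D B := by
  intro h
  obtain ⟨B, -, hB, hPE⟩ := h quad isSemialgebraic_quad (fun x hx => hx) (fun x _ y hy i => (hy i).1)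
  have := volume_eq_of_rel hE hPE
  rw [volume_quad] at this
  exact hB.measure_lt_top.ne this.symm

/-! ### `stub_mosaic`: strictness and semialgebraicity of BOTH sets are load-bearing -/

/-- Dropping `volume B < volume A` altogether: `B = (0,2)²` does not embed into `A = (0,1)²`. -/
theorem mosaic_false_without_lt :
    ¬ ∀ A B : Set (Fin 2 → ℝ), IsSemialgebraic ℚ A → IsSemialgebraic ℚ B → Bornology.IsBounded A →
      Bornology.IsBounded B → ∃ W : Set (Fin 2 → ℝ), W ⊆ A ∧ IsSemialgebraic ℚ W ∧ E B W := by
  intro h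
  obtain ⟨W, hWA, -, hPE⟩ := h sq bigSq isSemialgebraic_sq isSemialgebraic_bigSq isBounded_sq isBounded_bigSq
  have h1 := volume_eq_of_rel hE hPE
  have h2 : volume W ≤ 1 := volume_sq ▸ measure_mono hWA
  rw [volume_bigSq] at h1
  rw [← h1] at h2
  norm_num at h2

/-- Dropping `IsSemialgebraic ℚ B`: `B = (0,1)² ∖ ratLines` (area `1 < 4`) has empty interior, so no open
`U ⊆ B` carries its area — `E B W` fails for every `W`. -/
theorem mosaic_false_without_semialgB :
    ¬ ∀ A B : Set (Fin 2 → ℝ), IsSemialgebraic ℚ A → Bornology.IsBounded A → Bornology.IsBounded B →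
      volume B < volume A → ∃ W : Set (Fin 2 → ℝ), W ⊆ A ∧ IsSemialgebraic ℚ W ∧ E B W := by
  intro h
  obtain ⟨W, -, -, hPE⟩ := h bigSq irrSq isSemialgebraic_bigSq isBounded_bigSq isBounded_irrSq
    (by rw [volume_irrSq, volume_bigSq]; norm_num)
  have := volume_eq_zero_of_rel_diff_ratLines hE hPE
  rw [show sq \ ratLines = irrSq from rfl, volume_irrSq] at this
  exact one_ne_zero this

/-- Dropping `IsSemialgebraic ℚ A`: `A = (0,2)² ∖ ratLines` (area `4 > 1`) contains no `ℚ`-semialgebraic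
set of positive area, while `E (0,1)² W` forces `volume W = 1`. -/
theorem mosaic_false_without_semialgA :
    ¬ ∀ A B : Set (Fin 2 → ℝ), IsSemialgebraic ℚ B → Bornology.IsBounded A → Bornology.IsBounded B →
      volume B < volume A → ∃ W : Set (Fin 2 → ℝ), W ⊆ A ∧ IsSemialgebraic ℚ W ∧ E B W := by
  intro h
  obtain ⟨W, hWA, hW, hPE⟩ := h irrBig sq isSemialgebraic_sq isBounded_irrBig isBounded_sq
    (by rw [volume_irrBig, volume_sq]; norm_num)
  have h1 := volume_eq_of_rel hE hPE
  rw [volume_sq, volume_eq_zero_of_isSemialgebraic_subset_diff_ratLines hW hWA] at h1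
  exact one_ne_zero h1

/-! ### `stub_teCalc` (refinement conjunct): semialgebraicity of the pieces is load-bearing -/

/-- Dropping `∀ i, IsSemialgebraic ℚ (A i)`: split the unit square into its rational-abscissa part `A 0`
and the irrational part `A 1` (area `1`, empty interior); `E (A 0 ∪ A 1) ((0,1)² ∪ ∅)` holds by `Φ = id`,
but `ℚ`-semialgebraic `C 1 0, C 1 1 ⊆ A 1` are null, so `volume (A 1 ∖ (C 1 0 ∪ C 1 1)) = 1 ≠ 0`. -/
theorem teCalc_refine_false_without_semialgA :
    ¬ ∀ (A B : Fin 2 → Set (Fin 2 → ℝ)), (∀ j, IsSemialgebraic ℚ (B j)) → Disjoint (A 0) (A 1) →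
      Disjoint (B 0) (B 1) → E (A 0 ∪ A 1) (B 0 ∪ B 1) →
      ∃ C D : Fin 2 → Fin 2 → Set (Fin 2 → ℝ), (∀ i j, IsSemialgebraic ℚ (C i j) ∧ IsSemialgebraic ℚ (D i j) ∧
        C i j ⊆ A i ∧ D i j ⊆ B j ∧ E (C i j) (D i j)) ∧
        (∀ i, Disjoint (C i 0) (C i 1) ∧ volume (A i \ (C i 0 ∪ C i 1)) = 0) ∧
        (∀ j, Disjoint (D 0 j) (D 1 j) ∧ volume (B j \ (D 0 j ∪ D 1 j)) = 0) := by
  intro h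
  have hu : (sq ∩ ratLines) ∪ (sq \ ratLines) = sq := inter_union_sdiff sq ratLines
  have hPE : E ((![sq ∩ ratLines, sq \ ratLines] : Fin 2 → Set (Fin 2 → ℝ)) 0 ∪
        (![sq ∩ ratLines, sq \ ratLines] : Fin 2 → Set (Fin 2 → ℝ)) 1)
      ((![sq, ∅] : Fin 2 → Set (Fin 2 → ℝ)) 0 ∪ (![sq, ∅] : Fin 2 → Set (Fin 2 → ℝ)) 1) := by
    simpa [hu] using rel_refl hE isSemialgebraic_sq isOpen_sq
  obtain ⟨C, D, hCD, hC, -⟩ := h ![sq ∩ ratLines, sq \ ratLines] ![sq, ∅]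
    (fun j => by fin_cases j <;> simp [isSemialgebraic_sq]) (disjoint_sdiff_inter.symm) (by simp) hPE
  obtain ⟨-, hnull⟩ := hC 1
  have h10 := volume_eq_zero_of_isSemialgebraic_subset_diff_ratLines (hCD 1 0).1 (hCD 1 0).2.2.1
  have h11 := volume_eq_zero_of_isSemialgebraic_subset_diff_ratLines (hCD 1 1).1 (hCD 1 1).2.2.1
  have hcup : volume (C 1 0 ∪ C 1 1) = 0 := measure_union_null h10 h11
  simp only [Matrix.cons_val_one, Matrix.cons_val_fin_one] at hnull
  rw [measure_sdiff_null hcup] at hnull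
  rw [show sq \ ratLines = irrSq from rfl, volume_irrSq] at hnull
  exact one_ne_zero hnull

/-- Dropping `∀ j, IsSemialgebraic ℚ (B j)`: the symmetric witness on the target side. -/
theorem teCalc_refine_false_without_semialgB :
    ¬ ∀ (A B : Fin 2 → Set (Fin 2 → ℝ)), (∀ i, IsSemialgebraic ℚ (A i)) → Disjoint (A 0) (A 1) →
      Disjoint (B 0) (B 1) → E (A 0 ∪ A 1) (B 0 ∪ B 1) →
      ∃ C D : Fin 2 → Fin 2 → Set (Fin 2 → ℝ), (∀ i j, IsSemialgebraic ℚ (C i j) ∧ IsSemialgebraic ℚ (D i j) ∧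
        C i j ⊆ A i ∧ D i j ⊆ B j ∧ E (C i j) (D i j)) ∧
        (∀ i, Disjoint (C i 0) (C i 1) ∧ volume (A i \ (C i 0 ∪ C i 1)) = 0) ∧
        (∀ j, Disjoint (D 0 j) (D 1 j) ∧ volume (B j \ (D 0 j ∪ D 1 j)) = 0) := by
  intro h
  have hu : (sq ∩ ratLines) ∪ (sq \ ratLines) = sq := inter_union_sdiff sq ratLines
  have hPE : E ((![sq, ∅] : Fin 2 → Set (Fin 2 → ℝ)) 0 ∪ (![sq, ∅] : Fin 2 → Set (Fin 2 → ℝ)) 1)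
      ((![sq ∩ ratLines, sq \ ratLines] : Fin 2 → Set (Fin 2 → ℝ)) 0 ∪
        (![sq ∩ ratLines, sq \ ratLines] : Fin 2 → Set (Fin 2 → ℝ)) 1) := by
    simpa [hu] using rel_refl hE isSemialgebraic_sq isOpen_sq
  obtain ⟨C, D, hCD, -, hD⟩ := h ![sq, ∅] ![sq ∩ ratLines, sq \ ratLines]
    (fun i => by fin_cases i <;> simp [isSemialgebraic_sq]) (by simp) (disjoint_sdiff_inter.symm) hPE
  obtain ⟨-, hnull⟩ := hD 1
  have h01 := volume_eq_zero_of_isSemialgebraic_subset_diff_ratLines (hCD 0 1).2.1 (hCD 0 1).2.2.2.1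
  have h11 := volume_eq_zero_of_isSemialgebraic_subset_diff_ratLines (hCD 1 1).2.1 (hCD 1 1).2.2.2.1
  have hcup : volume (D 0 1 ∪ D 1 1) = 0 := measure_union_null h01 h11
  simp only [Matrix.cons_val_one, Matrix.cons_val_fin_one] at hnull
  rw [measure_sdiff_null hcup] at hnull
  rw [show sq \ ratLines = irrSq from rfl, volume_irrSq] at hnull
  exact one_ne_zero hnull

/-! ### `stub_groundLast`: semialgebraicity of `S` is load-bearing -/

/-- Dropping `IsSemialgebraic ℚ S`: `S = (0,1)² ∖ ratLines` has area `1` but empty interior, so `E S T` fails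
for EVERY `T`, in particular for `T = Grounding.groundLast S`. -/
theorem groundLast_false_without_semialg :
    ¬ ∀ S : Set (Fin 2 → ℝ), volume S ≠ ⊤ → E S (Grounding.groundLast S) := by
  intro h
  have := volume_eq_zero_of_rel_diff_ratLines hE (h irrSq (by rw [volume_irrSq]; exact ENNReal.one_ne_top))
  rw [show sq \ ratLines = irrSq from rfl, volume_irrSq] at this
  exact one_ne_zero this

end Pinned

end Summit.KontsevichZagierPeriods.KontsevichZagierPeriods.Theorems.PlanarSAZylev.Negative
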